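import Literature.NumberTheory.EllipticCurves.NewformsHeckeProofs
import Mathlib.NumberTheory.ModularForms.Bounds
import Mathlib.Analysis.Complex.Polynomial.Basic
import HarnessLib

/-!
# The trivial bound `|μ| ≤ 2p` for the eigenvalues of `T_p` on `S₂(Γ₀(N))`

Route `ABC/IsogenyGlueCongruence`, support item `SemistableHeightPolyBound` (`stmt-ABC-13918`):
helper file. For a prime `p ∤ N`, every eigenvalue `μ` of the Hecke operator `T_p` on the weight-2
cusp forms of level `Γ₀(N)` satisfies `‖μ‖ ≤ 2p`. This crude substitute for the
Ramanujan–Petersson/Deligne bound `|μ| ≤ 2√p` is all that the `N log N`-type bound for the modular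
degree needs, and it is elementary: if `T_p g = μ g` with `g ≠ 0`, the coefficients
`b_j = a_{p^j n₀}(g)` along the first non-vanishing index `n₀` satisfy `b₁ = μ b₀`,
`b_{j+2} = μ b_{j+1} − p b_j` (the `q`-expansion of `T_p`, Diamond–Shurman Prop. 5.3.1, PROVED in
the tree as `qExpansion_coeff_heckeT_holds`), while Hecke's trivial estimate `a_n(g) = O(n)`
(Mathlib `CuspFormClass.qExpansion_isBigO`) forces both roots of `X² − μX + p` to have absolute
value `≤ p`.

## References

* F. Diamond, J. Shurman, *A first course in modular forms*, GTM 228 (2005), Prop. 5.3.1 (the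
  `q`-expansion of `T_p`) and Prop. 5.9.1 / §5.9 (Hecke's estimate `a_n = O(n^{k/2})`).
-/

noncomputable section

open scoped MatrixGroups ModularForm
open CongruenceSubgroup UpperHalfPlane Filter Asymptotics
open Literature.NumberTheory.EllipticCurves.ModularForms

-- `Summit.<Summit>.<Problem>` is the mandated summit-side namespace (CONVENTIONS §2); for the
-- single-conjunct summit `ABC` the two coincide, so the duplicate `ABC.ABC` is deliberate.
set_option linter.dupNamespace false

namespace Summit.ABC.ABC.Theorems

/-- **Root bound for a Hecke-type recurrence.** Let `b : ℕ → ℂ` satisfy `b 0 ≠ 0`,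
`b 1 = μ b 0` and `b (j+2) = μ b (j+1) − p b j` (`p ≥ 1`), and grow at most like `K p^j` from
some index on. Then every root `γ` of `X² − μ X + p` has `‖γ‖ ≤ p`: with `δ = μ − γ` (so
`γδ = p`) the combination `u_j = b (j+1) − δ b j` equals `γ^{j+1} b 0`, and if `‖γ‖ > p` then
`‖δ‖ < 1` and `‖γ‖^{j+1} ‖b 0‖ ≤ 2 K p^{j+1}`, impossible for large `j`. [folklore] -/
theorem norm_le_of_quadratic_root_of_recurrence {μ γ : ℂ} {p : ℕ} (hp : 1 ≤ p) {b : ℕ → ℂ}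
    (hb0 : b 0 ≠ 0) (hb1 : b 1 = μ * b 0) (hrec : ∀ j, b (j + 2) = μ * b (j + 1) - p * b j)
    {K : ℝ} {J : ℕ} (hK : ∀ j, J ≤ j → ‖b j‖ ≤ K * (p : ℝ) ^ j)
    (hγ : γ ^ 2 - μ * γ + p = 0) : ‖γ‖ ≤ p := by
  by_contra hlt
  push Not at hlt
  set δ : ℂ := μ - γ with hδ
  have hγδ : γ * δ = p := by rw [hδ]; linear_combination -hγ
  -- `u_j = b (j+1) - δ b j = γ^(j+1) b 0`
  have hu : ∀ j, b (j + 1) - δ * b j = γ ^ (j + 1) * b 0 := by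
    intro j
    induction j with
    | zero => rw [hb1, hδ]; ring
    | succ j ih =>
      have h1 : b (j + 1 + 1) = μ * b (j + 1) - p * b j := hrec j
      calc b (j + 1 + 1) - δ * b (j + 1)
          = γ * (b (j + 1) - δ * b j) := by rw [h1, ← hγδ, hδ]; ring
        _ = γ ^ (j + 1 + 1) * b 0 := by rw [ih]; ring
  have hp0 : (0 : ℝ) < p := by exact_mod_cast hp
  have hγ0 : 0 < ‖γ‖ := hp0.trans hlt
  -- `‖δ‖ < 1`
  have hδ1 : ‖δ‖ < 1 := by
    have hprod : ‖γ‖ * ‖δ‖ = p := by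
      rw [← norm_mul, hγδ, Complex.norm_natCast]
    by_contra hge
    push Not at hge
    have : (p : ℝ) < ‖γ‖ * ‖δ‖ := by nlinarith
    linarith
  -- `K ≥ 0`
  have hK0 : 0 ≤ K := by
    have h := hK J le_rfl
    have hpJ : (0 : ℝ) < (p : ℝ) ^ J := pow_pos hp0 J
    nlinarith [norm_nonneg (b J)]
  -- the bound `‖γ‖^(j+1) ‖b 0‖ ≤ 2 K p^(j+1)` for `j ≥ J`
  have hbound : ∀ j, J ≤ j → ‖γ‖ ^ (j + 1) * ‖b 0‖ ≤ 2 * K * (p : ℝ) ^ (j + 1) := by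
    intro j hj
    have h1 : ‖γ‖ ^ (j + 1) * ‖b 0‖ = ‖b (j + 1) - δ * b j‖ := by
      rw [hu j, norm_mul, norm_pow]
    have h2 : ‖b (j + 1) - δ * b j‖ ≤ ‖b (j + 1)‖ + ‖δ‖ * ‖b j‖ := by
      calc ‖b (j + 1) - δ * b j‖ ≤ ‖b (j + 1)‖ + ‖δ * b j‖ := norm_sub_le _ _
        _ = ‖b (j + 1)‖ + ‖δ‖ * ‖b j‖ := by rw [norm_mul]
    have h3 : ‖b (j + 1)‖ ≤ K * (p : ℝ) ^ (j + 1) := hK (j + 1) (by omega)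
    have h4 : ‖δ‖ * ‖b j‖ ≤ K * (p : ℝ) ^ (j + 1) := by
      calc ‖δ‖ * ‖b j‖ ≤ 1 * (K * (p : ℝ) ^ j) :=
            mul_le_mul hδ1.le (hK j hj) (norm_nonneg _) zero_le_one
        _ = K * (p : ℝ) ^ j := one_mul _
        _ ≤ K * (p : ℝ) ^ (j + 1) := by
            apply mul_le_mul_of_nonneg_left _ hK0
            exact pow_le_pow_right₀ (by exact_mod_cast hp) (by omega)
    linarith
  -- the ratio `r = ‖γ‖ / p > 1` has unbounded powers
  set r : ℝ := ‖γ‖ / p with hr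
  have hr1 : 1 < r := by rw [hr, one_lt_div hp0]; exact hlt
  have hb0' : 0 < ‖b 0‖ := norm_pos_iff.mpr hb0
  have hev := ((tendsto_pow_atTop_atTop_of_one_lt hr1).eventually_gt_atTop
    (2 * K / ‖b 0‖)).and (eventually_ge_atTop (J + 1))
  obtain ⟨n, hn, hnJ⟩ := hev.exists
  obtain ⟨j, rfl⟩ : ∃ j, n = j + 1 := ⟨n - 1, by omega⟩
  have hj : J ≤ j := by omega
  have h := hbound j hj
  -- `r^(j+1) ≤ 2K/‖b 0‖`
  have hpj : (0 : ℝ) < (p : ℝ) ^ (j + 1) := pow_pos hp0 _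
  have hrpow : r ^ (j + 1) = ‖γ‖ ^ (j + 1) / (p : ℝ) ^ (j + 1) := by rw [hr, div_pow]
  have hle : r ^ (j + 1) ≤ 2 * K / ‖b 0‖ := by
    rw [hrpow, div_le_div_iff₀ hpj hb0']
    linarith
  linarith

/-- **The trivial bound for Hecke eigenvalues in weight 2.** For a prime `p ∤ N`, every eigenvalue
`μ` of `T_p` on `S₂(Γ₀(N))` satisfies `‖μ‖ ≤ 2p`. Proof: for an eigenvector `g ≠ 0` let `n₀` be
the least index with `a_{n₀}(g) ≠ 0`; by the `q`-expansion of `T_p`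
(`a_m(T_p g) = a_{pm}(g) + p·𝟙_{p∣m} a_{m/p}(g)`, `qExpansion_coeff_heckeT_holds`) the sequence
`b_j = a_{p^j n₀}(g)` satisfies `b₁ = μ b₀`, `b_{j+2} = μ b_{j+1} − p b_j`; by Hecke's estimate
`a_n(g) = O(n)` (Mathlib `CuspFormClass.qExpansion_isBigO`) `‖b_j‖ ≤ K p^j`, so both roots of
`X² − μX + p` have absolute value `≤ p` (`norm_le_of_quadratic_root_of_recurrence`) and
`‖μ‖ ≤ 2p`. [cite: DiamondShurman2005, Prop. 5.3.1 and §5.9 (Hecke's estimate)] -/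
theorem norm_le_two_mul_of_hasEigenvalue_heckeT_two (N : ℕ) [NeZero N] (p : ℕ) [NeZero p]
    (hp : p.Prime) (hpN : ¬ p ∣ N) (μ : ℂ)
    (hμ : Module.End.HasEigenvalue (heckeT (Gamma0 N) 2 p) μ) : ‖μ‖ ≤ 2 * p := by
  classical
  obtain ⟨g, hg⟩ := hμ.exists_hasEigenvector
  have hTg : heckeT (Gamma0 N) 2 p g = μ • g := hg.apply_eq_smul
  have hg0 : g ≠ 0 := (Module.End.hasEigenvector_iff.mp hg).2
  have hΓ := one_mem_strictPeriods_gamma0 N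
  -- the coefficients
  set a : ℕ → ℂ := fun n ↦ (qExpansion 1 ⇑g).coeff n with ha
  have hex : ∃ n, a n ≠ 0 := by
    by_contra h
    push Not at h
    apply hg0
    have hq : qExpansion 1 ⇑g = 0 := PowerSeries.ext fun n ↦ by simpa [ha] using h n
    have hcoe : (⇑g : ℍ → ℂ) = 0 :=
      (qExpansion_eq_zero_iff one_pos (SlashInvariantFormClass.periodic_comp_ofComplex g hΓ)
        (ModularFormClass.holo g) (ModularFormClass.bdd_at_infty g)).1 hq
    exact DFunLike.coe_injective (by simpa using hcoe)
  set n₀ := Nat.find hex with hn₀_def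
  have hn₀ : a n₀ ≠ 0 := Nat.find_spec hex
  have hmin : ∀ m < n₀, a m = 0 := fun m hm ↦ by
    have := Nat.find_min hex hm
    simpa using this
  have ha0 : a 0 = 0 := CuspFormClass.qExpansion_coeff_zero g one_pos hΓ
  have hn₀pos : 0 < n₀ := by
    rcases Nat.eq_zero_or_pos n₀ with h | h
    · exact absurd (h ▸ ha0 : a n₀ = 0) hn₀
    · exact h
  -- the `q`-expansion of `T_p g = μ g`
  have key : ∀ m, μ * a m = a (p * m) + (p : ℂ) * (if p ∣ m then a (m / p) else 0) := by
    intro m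
    have h := qExpansion_coeff_heckeT_holds N 2 g p hp m
    rw [hTg, qExpansion_coeff_smul, if_neg hpN] at h
    have h21 : ((2 : ℤ) - 1) = 1 := by norm_num
    rw [h21, zpow_one] at h
    simpa [ha] using h
  -- the sequence `b_j = a (p^j n₀)`
  set b : ℕ → ℂ := fun j ↦ a (p ^ j * n₀) with hb
  have hb0 : b 0 ≠ 0 := by simpa [hb] using hn₀
  have hb1 : b 1 = μ * b 0 := by
    have h := key n₀
    have hz : (if p ∣ n₀ then a (n₀ / p) else 0) = 0 := by
      split_ifs with hd
      · exact hmin _ (Nat.div_lt_self hn₀pos hp.one_lt)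
      · rfl
    rw [hz, mul_zero, add_zero] at h
    simp only [hb, pow_one, pow_zero, one_mul]
    exact h.symm
  have hrec : ∀ j, b (j + 2) = μ * b (j + 1) - p * b j := by
    intro j
    have h := key (p ^ (j + 1) * n₀)
    have hd : p ∣ p ^ (j + 1) * n₀ := dvd_mul_of_dvd_left (dvd_pow_self p (Nat.succ_ne_zero j)) _
    rw [if_pos hd] at h
    have hdiv : p ^ (j + 1) * n₀ / p = p ^ j * n₀ := by
      rw [show p ^ (j + 1) * n₀ = p * (p ^ j * n₀) by ring, Nat.mul_div_cancel_left _ hp.pos]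
    have hmul : p * (p ^ (j + 1) * n₀) = p ^ (j + 2) * n₀ := by ring
    rw [hmul, hdiv] at h
    simp only [hb]
    linear_combination -h
  -- Hecke's estimate `a_n = O(n)`
  have hO := CuspFormClass.qExpansion_isBigO g
  rw [strictWidthInfty_Gamma0] at hO
  obtain ⟨C, hC⟩ := hO.bound
  obtain ⟨n₁, hn₁⟩ := eventually_atTop.1 hC
  have hK : ∀ j, n₁ ≤ j → ‖b j‖ ≤ (max C 0 * n₀) * (p : ℝ) ^ j := by
    intro j hj
    have hjp : j ≤ p ^ j := (Nat.lt_pow_self hp.one_lt).le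
    have hle : n₁ ≤ p ^ j * n₀ := hj.trans (hjp.trans (Nat.le_mul_of_pos_right _ hn₀pos))
    have h := hn₁ (p ^ j * n₀) hle
    have hexp : (((2 : ℤ) : ℝ) / 2) = 1 := by norm_num
    rw [hexp, Real.rpow_one, Real.norm_natCast] at h
    calc ‖b j‖ = ‖a (p ^ j * n₀)‖ := rfl
      _ ≤ C * ((p ^ j * n₀ : ℕ) : ℝ) := h
      _ ≤ max C 0 * ((p ^ j * n₀ : ℕ) : ℝ) := by gcongr; exact le_max_left _ _
      _ = (max C 0 * n₀) * (p : ℝ) ^ j := by push_cast; ring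
  -- the roots of `X² - μ X + p`
  obtain ⟨s, hs⟩ := IsAlgClosed.exists_pow_nat_eq (μ ^ 2 - 4 * p) two_pos
  set α : ℂ := (μ + s) / 2 with hα_def
  have hα : α ^ 2 - μ * α + p = 0 := by rw [hα_def]; linear_combination hs / 4
  set β : ℂ := μ - α with hβ_def
  have hβ : β ^ 2 - μ * β + p = 0 := by rw [hβ_def]; linear_combination hα
  have hαn := norm_le_of_quadratic_root_of_recurrence hp.one_le hb0 hb1 hrec hK hα
  have hβn := norm_le_of_quadratic_root_of_recurrence hp.one_le hb0 hb1 hrec hK hβ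
  calc ‖μ‖ = ‖α + β‖ := by rw [hβ_def]; ring_nf
    _ ≤ ‖α‖ + ‖β‖ := norm_add_le _ _
    _ ≤ p + p := add_le_add hαn hβn
    _ = 2 * p := by ring

end Summit.ABC.ABC.Theorems

end
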